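import Mathlib
import HarnessLib
import Summits.HubbardSuperconductivity.HubbardSuperconductivity.Theorems.KLProgrammeKLRegimeEngineV8DefsG5Reading

/-!
# K3 engine package `klEngGeo5`: booking a FORWARD-BUBBLE bound of the shape `U²·(c₁·L_W·Λ_n + c₂·B_W·(π/β)/Λ_n + c₃·B_W·ρ/Λ_n)` on the (X) line
# (cell gate-hubbard-kl, seat hubbard-kl-k3c2-p2 g6; companion of `…EngineV8DefsG5Reading`)

The forward particle–hole bubble suppliers of this seat (`klfb_planar_sliceBubble_norm_le`, `klfp_planar_softBubble_norm_le`, `klfl_lattice_forward_bubble_norm_le`,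
…) deliver, at scale `n ≤ n_β + 1` and transfer size `ρ`, a bound of the shape `c₁·L_W·Λ_n + c₂·B_W·(π/β)/Λ_n + c₃·B_W·ρ/Λ_n` (`Λ_n = klScale klE0 n = klE0·4^{-n}`;
`L_W`, `B_W` the Lipschitz constant / sup of the ray insertion `W_θ = 𝒥·A`, `c_i` numerals such as `2^25, 2^25, 2^21`).  This file turns such a bound — times the
two local couplings `U²` — into hypothesis (2) of `klg5_phGain_reading` plus the thermal booking, under NUMERAL hypotheses on `c₁L_W`, `c₂B_W`, `c₃B_W` only:

* **`klg5_below_add_thermal_of_forward`**: `b ≤ U²·(c₁L_WΛ_n + c₂B_W(π/β)/Λ_n + c₃B_Wρ/Λ_n)`, `c₁L_W ≤ 2^57`, `4·c₂B_W ≤ 2^80`, `c₃B_W ≤ 2^52` (all `≥ 0`), `Klam ≥ 1`,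
  `ρ ≥ 0`, `n ≤ n_β + 1`, `β ≥ klBetaMin` ⇒ `b ≤ (Klam U)²·2^28·BELOW(ρ) + thermalBar klEngGeo5 P U β n` with `BELOW(ρ) = 2^24·4^{-n} + 2^24·ρ/klE0·4^n`;
* `klg5_gainBar_of_slots`: three slot bookings `bpp ≤ (Klam U)²·ppGain n ρpp`, `bd ≤ (Klam U)²·phGain n ρd`, `bx ≤ (Klam U)²·phGain n ρx` add up to `gainBar klEngGeo5 P U n ρpp ρd ρx`.

Pure order arithmetic; nothing about the model is asserted.
-/

noncomputable section

namespace Summit.HubbardSuperconductivity.HubbardSuperconductivity.Theorems.EngineV8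

set_option linter.dupNamespace false -- summit = problem name (single-conjunct summit), D-0017

open Real Finset Literature.MathematicalPhysics.QuantumLattice Literature.Probability.LatticeModels
open Summit.HubbardSuperconductivity.HubbardSuperconductivity.Theorems.KLRegimeSplit
open Summit.HubbardSuperconductivity.HubbardSuperconductivity.Theorems.KLProgrammeLegKernels

/-- **Booking a forward-bubble bound on the (X) line at `klEngGeo5`.**  If `b ≤ U²·(c₁·L_W·Λ_n + c₂·B_W·(π/β)/Λ_n + c₃·B_W·ρ/Λ_n)` with
`0 ≤ c₁L_W ≤ 2^57`, `0 ≤ c₂B_W`, `4·c₂B_W ≤ 2^80`, `0 ≤ c₃B_W ≤ 2^52`, then for `Klam ≥ 1`, `ρ ≥ 0`, `n ≤ n_β + 1`, `β ≥ klBetaMin`: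
`b ≤ (Klam U)²·2^28·(2^24·4^{-n} + 2^24·ρ/klE0·4^n) + thermalBar klEngGeo5 P U β n` — hypothesis (2) of `klg5_phGain_reading` with `T = thermalBar …`. -/
theorem klg5_below_add_thermal_of_forward {P : SplitConsts} {U β ρ b L_W B_W c₁ c₂ c₃ : ℝ} {n : ℕ} (hK : 1 ≤ P.Klam) (hρ : 0 ≤ ρ)
    (hβ : klBetaMin ≤ β) (hn : n ≤ nScales β + 1)
    (h1 : 0 ≤ c₁ * L_W) (h1' : c₁ * L_W ≤ 2 ^ 57) (h2 : 0 ≤ c₂ * B_W) (h2' : 4 * (c₂ * B_W) ≤ 2 ^ 80) (h3 : 0 ≤ c₃ * B_W)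
    (h3' : c₃ * B_W ≤ 2 ^ 52)
    (hb : b ≤ U ^ 2 * (c₁ * L_W * klScale klE0 n + c₂ * B_W * ((Real.pi / β) / klScale klE0 n) + c₃ * B_W * ρ / klScale klE0 n)) :
    b ≤ (P.Klam * U) ^ 2 * 2 ^ 28 * (2 ^ 24 * ((4 : ℝ) ^ n)⁻¹ + 2 ^ 24 * ρ / klE0 * (4 : ℝ) ^ n) + thermalBar klEngGeo5 P U β n := by
  have hΛ : 0 < klScale klE0 n := klth_klScale_pos n
  have h4n : 0 < (4 : ℝ) ^ n := by positivity
  have hU2 : 0 ≤ U ^ 2 := sq_nonneg U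
  have hKU : U ^ 2 ≤ (P.Klam * U) ^ 2 := by
    rw [mul_pow]
    have h1K : (1 : ℝ) ≤ P.Klam ^ 2 := one_le_pow₀ hK
    nlinarith
  have hKU0 : 0 ≤ (P.Klam * U) ^ 2 := sq_nonneg _
  -- the thermal piece
  have hT : U ^ 2 * (c₂ * B_W * ((Real.pi / β) / klScale klE0 n)) ≤ thermalBar klEngGeo5 P U β n := by
    have hratio : 0 ≤ (Real.pi / β) / klScale klE0 n :=
      div_nonneg (div_nonneg Real.pi_pos.le ((by norm_num [klBetaMin] : (0 : ℝ) ≤ klBetaMin).trans hβ)) hΛ.le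
    have hstep : U ^ 2 * (c₂ * B_W * ((Real.pi / β) / klScale klE0 n)) ≤
        c₂ * B_W * (P.Klam * U) ^ 2 * ((Real.pi / β) / klScale klE0 n) := by
      have := mul_le_mul_of_nonneg_left hKU (mul_nonneg h2 hratio)
      nlinarith
    exact hstep.trans (klte_ratio_mul_le_thermalBar h2 (h2'.trans two_pow_le_klEngGeo5_CF) P U hβ hn)
  -- the zero-sound piece: `U²·c₁L_W·Λ_n ≤ (Klam U)²·2^52·4^{-n}`
  have hZ : U ^ 2 * (c₁ * L_W * klScale klE0 n) ≤ (P.Klam * U) ^ 2 * 2 ^ 28 * (2 ^ 24 * ((4 : ℝ) ^ n)⁻¹) := by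
    have hsc : klScale klE0 n = klE0 * ((4 : ℝ) ^ n)⁻¹ := rfl
    rw [hsc]
    unfold klE0
    have hi : 0 ≤ ((4 : ℝ) ^ n)⁻¹ := by positivity
    have : c₁ * L_W * (1 / 32 * ((4 : ℝ) ^ n)⁻¹) ≤ 2 ^ 28 * (2 ^ 24 * ((4 : ℝ) ^ n)⁻¹) := by
      have h57 := mul_le_mul_of_nonneg_right h1' hi
      have e : (2 : ℝ) ^ 28 * (2 ^ 24 * ((4 : ℝ) ^ n)⁻¹) = 2 ^ 57 * (1 / 32 * ((4 : ℝ) ^ n)⁻¹) := by ring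
      rw [e, ← mul_assoc] at *
      nlinarith
    calc U ^ 2 * (c₁ * L_W * (1 / 32 * ((4 : ℝ) ^ n)⁻¹)) ≤ (P.Klam * U) ^ 2 * (c₁ * L_W * (1 / 32 * ((4 : ℝ) ^ n)⁻¹)) :=
          mul_le_mul_of_nonneg_right hKU (by positivity)
      _ ≤ (P.Klam * U) ^ 2 * (2 ^ 28 * (2 ^ 24 * ((4 : ℝ) ^ n)⁻¹)) := mul_le_mul_of_nonneg_left this hKU0
      _ = (P.Klam * U) ^ 2 * 2 ^ 28 * (2 ^ 24 * ((4 : ℝ) ^ n)⁻¹) := by ring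
  -- the transfer piece: `U²·c₃B_W·ρ/Λ_n ≤ (Klam U)²·2^52·ρ/klE0·4^n`
  have hS : U ^ 2 * (c₃ * B_W * ρ / klScale klE0 n) ≤ (P.Klam * U) ^ 2 * 2 ^ 28 * (2 ^ 24 * ρ / klE0 * (4 : ℝ) ^ n) := by
    have hsc : klScale klE0 n = klE0 * ((4 : ℝ) ^ n)⁻¹ := rfl
    have hrew : c₃ * B_W * ρ / klScale klE0 n = c₃ * B_W * (ρ / klE0 * (4 : ℝ) ^ n) := by
      rw [hsc]; field_simp
    rw [hrew]
    have hq : 0 ≤ ρ / klE0 * (4 : ℝ) ^ n := by unfold klE0; positivity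
    have : c₃ * B_W * (ρ / klE0 * (4 : ℝ) ^ n) ≤ 2 ^ 28 * (2 ^ 24 * ρ / klE0 * (4 : ℝ) ^ n) := by
      have h52 := mul_le_mul_of_nonneg_right h3' hq
      have e : (2 : ℝ) ^ 28 * (2 ^ 24 * ρ / klE0 * (4 : ℝ) ^ n) = 2 ^ 52 * (ρ / klE0 * (4 : ℝ) ^ n) := by ring
      rw [e]; exact h52
    calc U ^ 2 * (c₃ * B_W * (ρ / klE0 * (4 : ℝ) ^ n)) ≤ (P.Klam * U) ^ 2 * (c₃ * B_W * (ρ / klE0 * (4 : ℝ) ^ n)) :=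
          mul_le_mul_of_nonneg_right hKU (mul_nonneg h3 hq)
      _ ≤ (P.Klam * U) ^ 2 * (2 ^ 28 * (2 ^ 24 * ρ / klE0 * (4 : ℝ) ^ n)) := mul_le_mul_of_nonneg_left this hKU0
      _ = (P.Klam * U) ^ 2 * 2 ^ 28 * (2 ^ 24 * ρ / klE0 * (4 : ℝ) ^ n) := by ring
  have hsplit : U ^ 2 * (c₁ * L_W * klScale klE0 n + c₂ * B_W * ((Real.pi / β) / klScale klE0 n) + c₃ * B_W * ρ / klScale klE0 n) =
      U ^ 2 * (c₁ * L_W * klScale klE0 n) + U ^ 2 * (c₂ * B_W * ((Real.pi / β) / klScale klE0 n)) +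
        U ^ 2 * (c₃ * B_W * ρ / klScale klE0 n) := by ring
  rw [hsplit] at hb
  have hgoal : (P.Klam * U) ^ 2 * 2 ^ 28 * (2 ^ 24 * ((4 : ℝ) ^ n)⁻¹ + 2 ^ 24 * ρ / klE0 * (4 : ℝ) ^ n) =
      (P.Klam * U) ^ 2 * 2 ^ 28 * (2 ^ 24 * ((4 : ℝ) ^ n)⁻¹) + (P.Klam * U) ^ 2 * 2 ^ 28 * (2 ^ 24 * ρ / klE0 * (4 : ℝ) ^ n) := by ring
  rw [hgoal]
  linarith

/-- **The three slot bookings add up to `gainBar`**: `bpp ≤ (Klam U)²·ppGain n ρpp`, `bd ≤ (Klam U)²·phGain n ρd`, `bx ≤ (Klam U)²·phGain n ρx` ⇒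
`bpp + bd + bx ≤ gainBar klEngGeo5 P U n ρpp ρd ρx` (in fact for any `G`). -/
theorem klg5_gainBar_of_slots (G : GeoConsts) {P : SplitConsts} {U bpp bd bx ρpp ρd ρx : ℝ} {n : ℕ}
    (hpp : bpp ≤ (P.Klam * U) ^ 2 * G.ppGain n ρpp) (hd : bd ≤ (P.Klam * U) ^ 2 * G.phGain n ρd)
    (hx : bx ≤ (P.Klam * U) ^ 2 * G.phGain n ρx) : bpp + bd + bx ≤ gainBar G P U n ρpp ρd ρx := by
  unfold gainBar; linarith

end Summit.HubbardSuperconductivity.HubbardSuperconductivity.Theorems.EngineV8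

end
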